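import Literature.MathematicalPhysics.PowerSystems.DVOCCollectiveAmplitudeGate
import HarnessLib

/-!
# The collective-amplitude dynamics of the reduced dVOC network in closed form: the loading identity
# `Sᵀe_θ(v) = 2Σ_k σ_k(…)/v_k⋆`, the amplitude pairing, and `d(r²)/dt = (2η/Λ²)Σ_iσ_i(v)σ_i(g(v))`
# along solutions of (17) (Groß–Colombino–Brouillon–Dörfler 2019, model (17); every `N`)

Topic `Literature/MathematicalPhysics/PowerSystems`, namespace
`Literature.MathematicalPhysics.PowerSystems.DvocReduced`; second of the four «collective-amplitude» modules
(`Gate` → **`Dynamics`** → `Barrier` → `Region`), continuing `DVOCCollectiveAmplitudeGate.lean`. MODELLED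
column: statements about the printed reduced-order model (17), `M = DvocReduced N`; nothing here says that a
converter, feeder or grid is stable. 0 named facts, 0 `decide`, instance-free; every statement PROVED.
Cell G2-SCALE lead §58 D74 (idea card «idea-2 (cycle 5) / collective-amplitude-gate-printed-gain-
certificate», support P2 / crux K1 algebra; scratch by gridfusion-g2-idea-2, `port/DVOCCollectiveAmplitudeGate.lean`
9a6b39836e226557 §3, checked rc 0 by gridfusion-g2-crit-1 STATUS l.10652 / l.10675); typed by gridfusion-lit-4
(g15), 2026-08-28.

## Sources (read on the page; `pNNNN Ln` = PDF page / line of the arXiv rendering, `chunk pNNNN` for the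
LaTeX chunks of arXiv:1710.00694)

* [GrossEtAl2019] arXiv:1802.08881 = IEEE TCNS 6 (2019) 1148: the reduced-order model (17) p0006 L9–16
  «d/dt v = f_v(v, i_s(v)) = η[(𝒦 − 𝓛)v + αΦ(v)v] (17) … (𝒦 − 𝓛)v = e_θ(v) which implies (𝒦 − 𝓛)v = 0
  for all v ∈ 𝒮»; §IV-D p0006 L37–46 (`S`, `P_S`, `Λ = Σ_i v_i⋆²`); Theorem 2 p0005 L69–76 («the origin
  0_n is an exponentially unstable equilibrium» — the amplitude dynamics ON `𝒮`, typed in the tree's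
  `DVOCStabilityCondition` §12 `field_embS` / `isSolutionOn_ray` / `ray_exp_growth`).
* [ColombinoEtAl2019] arXiv:1710.00694 = IEEE TAC 64 (2019) 4496: Prop. 10 and its proof, chunk p0015
  L56–75 («the set 𝒮 is positively invariant … d/dt W_k ≤ −2W_k‖v̄_k‖ ≤ 0» — asymptotic stability of `𝒜` in
  `𝒮 ∖ {0}`, i.e. the amplitude dynamics restricted to `𝒮`).

## What is printed and what is this file's

PRINTED: the model (17); on `𝒮` its field is radial with logistic amplitude dynamics (tree §12; the `δ = 0`
case of everything below). THIS FILE (the idea card's derivation, proved for every `N`, symmetric weights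
`w_kj = w_jk`, `v_k⋆ ≠ 0`): (i) the LOADING IDENTITY `S(a,b)ᵀ e_θ(v) = 2 Σ_k σ_k (a (R(−θ_k)v_k)₂ −
b (R(−θ_k)v_k)₁)/v_k⋆` (`dot_embS_eθ`) with the rotated reactive-type node loadings at the steady state
`σ_k := Σ_j w_kj v_k⋆ v_j⋆ sin(θ_j − θ_k)` (`loadSig`) — swap the neighbour term by symmetry,
`R(θ_j) − R(2θ_k − θ_j) = 2 sin(θ_j − θ_k) R(θ_k) J` — and it only sees `δ = P_S v` (`dot_embS_eθ_eq_projS`);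
(ii) the AMPLITUDE PAIRING `⟨s(v), Φ(v)v⟩ = r²(Λ(1 − r²) − ‖v‖²_S) − Σ_k (2a_k + b_k)a_k/v_k⋆²`
(`dot_syncPart_PhiVec`) and `Σ_iσ_i(v)σ_i(w) = Λ⟨s(v), w⟩` (`sig_pair_eq`); (iii) the CLOSED FORM
`Σ_i σ_i(v)σ_i(g(v)) = Λα[r²(Λ(1−r²) − ‖δ‖²) − Σ_k(2a_k + b_k)a_k/v_k⋆²] + 2Σ_kσ_k(σ₁(v)(R(−θ_k)δ_k)₂ −
σ₂(v)(R(−θ_k)δ_k)₁)/v_k⋆` (`sig_pair_gVec_closed_form`), and (iv) `d(r²)/dt = (2η/Λ²)Σ_iσ_i(v)σ_i(g(v))`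
along any solution of (17) (`hasDerivWithinAt_rSq`, from the tree's componentwise derivatives); plus the
elementary `Λ > 0` and the Cauchy–Schwarz step `a_k² ≤ r² v_k⋆² b_k` (`radDis_sq_le`). On `𝒮` (`δ = 0`,
`a_k = b_k = 0`) (iii) reads `Σ_iσ_iσ_i(g) = Λ²α r²(1 − r²)`, the logistic law of the tree's §12. No
barrier, no region, no instance here (modules `Barrier`, `Region`). Nothing in this file certifies a real grid.
-/

noncomputable section

namespace Literature.MathematicalPhysics.PowerSystems

open Finset Real

namespace DvocReduced

variable {N : ℕ} (W : DvocReduced N)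

/-- Rotated reactive-type LOADING of node `k` at the steady state, `σ_k := Σ_j w_kj v_k⋆ v_j⋆ sin(θ_j − θ_k)`
(this file's abbreviation for the coefficient of `Sᵀe_θ`; for symmetric `w`, `Σ_k σ_k = 0`).
[cite: GrossEtAl2019, (17) p0006 L9–16 (`(𝒦 − 𝓛)v = e_θ(v)`) and §IV-D p0006 L37–46 (`S`)] -/
def loadSig (k : Fin N) : ℝ := ∑ j, W.w k j * W.vref k * W.vref j * sin (W.θ j - W.θ k)

/-- Co-rotated coordinates `(R(−θ_k) v_k)₁` (node `k` read in the frame of its steady-state angle `θ_k⋆`).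
[cite: GrossEtAl2019, §IV-D p0006 L37–46 (`S = [v_k⋆ R(θ_1k⋆)ᵀ]_k`)] -/
def rot₁ (v : DvocState N) (k : Fin N) : ℝ := cos (W.θ k) * v.1 k + sin (W.θ k) * v.2 k

/-- Co-rotated coordinates `(R(−θ_k) v_k)₂`. [cite: GrossEtAl2019, §IV-D p0006 L37–46] -/
def rot₂ (v : DvocState N) (k : Fin N) : ℝ := -sin (W.θ k) * v.1 k + cos (W.θ k) * v.2 k

/-- Rotation preserves the node norm: `(R(−θ_k)v_k)₁² + (R(−θ_k)v_k)₂² = ‖v_k‖²` (the rotations `R(θ_1k⋆)` of the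
printed `S`-matrix are orthogonal). [cite: GrossEtAl2019, §IV-D p0006 L37–46 (`S = [v_k⋆R(θ_1k⋆)ᵀ]_k`)] -/
theorem rot_nsq (v : DvocState N) (k : Fin N) :
    W.rot₁ v k ^ 2 + W.rot₂ v k ^ 2 = dvocNsq v k := by
  have sck := sin_sq_add_cos_sq (W.θ k)
  unfold rot₁ rot₂ dvocNsq
  linear_combination (v.1 k ^ 2 + v.2 k ^ 2) * sck

/-- **Loading identity** (`Sᵀ e_θ` in closed form). For symmetric weights and `v_k⋆ ≠ 0`,
`S(a,b)ᵀ e_θ(v) = 2 Σ_k σ_k (a (R(−θ_k)v_k)₂ − b (R(−θ_k)v_k)₁)/v_k⋆`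
(swap the neighbour term by symmetry; `R(θ_j) − R(2θ_k − θ_j) = 2 sin(θ_j − θ_k) R(θ_k) J`). On `𝒮` both sides
vanish (printed: «(𝒦 − 𝓛)v = 0 for all v ∈ 𝒮»). [cite: GrossEtAl2019, (17) p0006 L9–16 and §IV-D p0006 L37–46] -/
theorem dot_embS_eθ (hw : ∀ k j, W.w k j = W.w j k) (hne : ∀ k, W.vref k ≠ 0) (a b : ℝ)
    (v : DvocState N) :
    dvocDot (W.embS a b) (W.eθ v)
      = 2 * ∑ k, W.loadSig k * (a * W.rot₂ v k - b * W.rot₁ v k) / W.vref k := by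
  -- the two pieces of `e_θ`: the neighbour term `A` and the rotated self term `B`
  set A : Fin N → Fin N → ℝ := fun k j =>
    W.vref k * ((cos (W.θ k) * a - sin (W.θ k) * b) * v.1 j
      + (sin (W.θ k) * a + cos (W.θ k) * b) * v.2 j) with hA
  set B : Fin N → Fin N → ℝ := fun k j =>
    W.vref j * ((cos (W.θ k) * a - sin (W.θ k) * b)
        * (cos (W.θ j - W.θ k) * v.1 k - sin (W.θ j - W.θ k) * v.2 k)
      + (sin (W.θ k) * a + cos (W.θ k) * b)
        * (sin (W.θ j - W.θ k) * v.1 k + cos (W.θ j - W.θ k) * v.2 k)) with hB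
  have h1 : dvocDot (W.embS a b) (W.eθ v) = ∑ k, ∑ j, (W.w k j * A k j - W.w k j * B k j) := by
    simp only [dvocDot, embS, eθ, eθ₁, eθ₂, Finset.mul_sum, ← Finset.sum_add_distrib]
    refine Finset.sum_congr rfl fun k _ => Finset.sum_congr rfl fun j _ => ?_
    have hk := hne k
    simp only [hA, hB]
    field_simp
    ring
  have h2 : ∑ k, ∑ j, W.w k j * A k j = ∑ k, ∑ j, W.w k j * A j k := by
    rw [Finset.sum_comm]
    exact Finset.sum_congr rfl fun k _ => Finset.sum_congr rfl fun j _ => by rw [hw]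
  have h3 : ∀ k j, W.w k j * A j k - W.w k j * B k j
      = W.w k j * (2 * W.vref j * sin (W.θ j - W.θ k) * (a * W.rot₂ v k - b * W.rot₁ v k)) := by
    intro k j
    have sck := sin_sq_add_cos_sq (W.θ k)
    simp only [hA, hB, rot₁, rot₂, Real.cos_sub, Real.sin_sub]
    linear_combination (-(W.w k j * W.vref j * (a * (cos (W.θ j) * v.1 k + sin (W.θ j) * v.2 k)
        + b * (-sin (W.θ j) * v.1 k + cos (W.θ j) * v.2 k)))) * sck
  calc dvocDot (W.embS a b) (W.eθ v)
      = ∑ k, ∑ j, W.w k j * A k j - ∑ k, ∑ j, W.w k j * B k j := by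
        rw [h1, ← Finset.sum_sub_distrib]
        exact Finset.sum_congr rfl fun k _ => (Finset.sum_sub_distrib _ _)
    _ = ∑ k, ∑ j, (W.w k j * A j k - W.w k j * B k j) := by
        rw [h2, ← Finset.sum_sub_distrib]
        exact Finset.sum_congr rfl fun k _ => (Finset.sum_sub_distrib _ _).symm
    _ = ∑ k, ∑ j, W.w k j
          * (2 * W.vref j * sin (W.θ j - W.θ k) * (a * W.rot₂ v k - b * W.rot₁ v k)) :=
        Finset.sum_congr rfl fun k _ => Finset.sum_congr rfl fun j _ => h3 k j
    _ = 2 * ∑ k, W.loadSig k * (a * W.rot₂ v k - b * W.rot₁ v k) / W.vref k := by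
        rw [Finset.mul_sum]
        refine Finset.sum_congr rfl fun k _ => ?_
        have hk := hne k
        rw [loadSig, Finset.sum_mul, Finset.sum_div, Finset.mul_sum]
        refine Finset.sum_congr rfl fun j _ => ?_
        field_simp

/-- The loading pairing only sees the disagreement `δ = P_S v` (`e_θ = e_θ ∘ P_S`, the tree's `eθ_projS`).
[cite: GrossEtAl2019, (17) p0006 L9–16 («(𝒦 − 𝓛)v = 0 for all v ∈ 𝒮»)] -/
theorem dot_embS_eθ_eq_projS (hw : ∀ k j, W.w k j = W.w j k) (hne : ∀ k, W.vref k ≠ 0)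
    (a b : ℝ) (v : DvocState N) :
    dvocDot (W.embS a b) (W.eθ v)
      = 2 * ∑ k, W.loadSig k * (a * W.rot₂ (W.projS v) k - b * W.rot₁ (W.projS v) k)
          / W.vref k := by
  have h : W.eθ v = W.eθ (W.projS v) := by
    refine Prod.ext (funext fun k => ?_) (funext fun k => ?_)
    · exact ((W.eθ_projS hne v k).1).symm
    · exact ((W.eθ_projS hne v k).2).symm
  rw [h]
  exact W.dot_embS_eθ hw hne a b (W.projS v)

/-- `Σ_i σ_i(v) σ_i(w) = Λ ⟨s(v), w⟩` (`s(v) = S Sᵀ v/Λ`, `σ = Sᵀ`). [cite: GrossEtAl2019, §IV-D p0006 L37–46] -/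
theorem sig_pair_eq (hΛ : W.Lam ≠ 0) (v w : DvocState N) :
    W.sig₁ v * W.sig₁ w + W.sig₂ v * W.sig₂ w = W.Lam * dvocDot (W.syncPart v) w := by
  have hcomm : dvocDot (W.syncPart v) w = dvocDot w (W.syncPart v) := by
    simp only [dvocDot]
    exact Finset.sum_congr rfl fun k _ => by ring
  rw [hcomm, syncPart, W.dot_embS]
  field_simp

/-- **Amplitude pairing.** `⟨s(v), Φ(v)v⟩ = r²(Λ(1 − r²) − ‖v‖²_S) − Σ_k (2a_k + b_k) a_k/v_k⋆²` (the
`𝒮`-component of the printed cubic term `Φ(v)v` of (17), in the `Gate` module's coordinates `r, a_k, b_k`).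
[cite: GrossEtAl2019, (17) p0006 L9–16 and proof of Lemma 1 p0011 L113–118] -/
theorem dot_syncPart_PhiVec (hΛ : W.Lam ≠ 0) (hne : ∀ k, W.vref k ≠ 0) (v : DvocState N) :
    dvocDot (W.syncPart v) (W.PhiVec v)
      = W.rSq v * (W.Lam * (1 - W.rSq v) - W.normS2 v)
        - ∑ k, (2 * W.radDis v k + dvocNsq (W.projS v) k) * W.radDis v k / W.vref k ^ 2 := by
  have h1 : dvocDot (W.syncPart v) (W.PhiVec v)
      = ∑ k, W.Phi v k * (W.rSq v * W.vref k ^ 2 + W.radDis v k) := by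
    simp only [dvocDot, PhiVec]
    refine Finset.sum_congr rfl fun k _ => ?_
    obtain ⟨e1, e2⟩ := W.syncPart_add_projS v k
    have hs := W.nsq_syncPart v k
    unfold dvocNsq at hs
    unfold radDis
    rw [← e1, ← e2]
    linear_combination (W.Phi v k) * hs
  have h2 : ∀ k, W.Phi v k * (W.rSq v * W.vref k ^ 2 + W.radDis v k)
      = ((1 - W.rSq v) * W.rSq v * W.vref k ^ 2 + (1 - 3 * W.rSq v) * W.radDis v k
        - W.rSq v * dvocNsq (W.projS v) k)
        - (2 * W.radDis v k + dvocNsq (W.projS v) k) * W.radDis v k / W.vref k ^ 2 := by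
    intro k
    rw [W.Phi_eq_gate v (hne k)]
    have hk := hne k
    field_simp
    ring
  have hsum := W.sum_radDis hΛ v
  have hn := W.normS2_eq_sum_nsq_projS hΛ v
  have hL : ∑ k, W.vref k ^ 2 = W.Lam := rfl
  rw [h1, Finset.sum_congr rfl fun k _ => h2 k, Finset.sum_sub_distrib, Finset.sum_sub_distrib,
    Finset.sum_add_distrib, ← Finset.mul_sum, ← Finset.mul_sum, ← Finset.mul_sum, hL, hsum, ← hn]
  ring

/-- `Σ_i σ_i(v) σ_i(g(v)) = Λ (⟨s, e_θ(v)⟩ + α ⟨s, Φ(v)v⟩)`, `g = e_θ + αΦ(v)v` the bracket of (17).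
[cite: GrossEtAl2019, (17) p0006 L9–16] -/
theorem sig_pair_gVec (hΛ : W.Lam ≠ 0) (v : DvocState N) :
    W.sig₁ v * W.sig₁ (W.gVec v) + W.sig₂ v * W.sig₂ (W.gVec v)
      = W.Lam * (dvocDot (W.syncPart v) (W.eθ v) + W.α * dvocDot (W.syncPart v) (W.PhiVec v)) := by
  rw [W.sig_pair_eq hΛ]
  congr 1
  simp only [dvocDot, gVec, g₁, g₂, eθ, PhiVec, Finset.mul_sum, ← Finset.sum_add_distrib]
  exact Finset.sum_congr rfl fun k _ => by ring

/-- **Closed form** of the collective-amplitude drive: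
`Σ_i σ_i(v) σ_i(g(v)) = Λ α [r²(Λ(1−r²) − ‖δ‖²) − Σ_k (2a_k + b_k)a_k/v_k⋆²]
  + 2 Σ_k σ_k (σ₁(v)(R(−θ_k)δ_k)₂ − σ₂(v)(R(−θ_k)δ_k)₁)/v_k⋆`.
On `𝒮` (`δ = 0`) this is `Λ²α r²(1 − r²)`: the logistic amplitude law of the tree's §12 (`field_embS`,
printed as the instability of `0_n` in Thm 2 and as [ColombinoEtAl2019, Prop. 10]); off `𝒮` the two
correction terms are this file's. [cite: GrossEtAl2019, (17) p0006 L9–16 and Thm 2 p0005 L69–76] -/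
theorem sig_pair_gVec_closed_form (hΛ : W.Lam ≠ 0) (hne : ∀ k, W.vref k ≠ 0)
    (hw : ∀ k j, W.w k j = W.w j k) (v : DvocState N) :
    W.sig₁ v * W.sig₁ (W.gVec v) + W.sig₂ v * W.sig₂ (W.gVec v)
      = W.Lam * W.α * (W.rSq v * (W.Lam * (1 - W.rSq v) - W.normS2 v)
            - ∑ k, (2 * W.radDis v k + dvocNsq (W.projS v) k) * W.radDis v k / W.vref k ^ 2)
        + 2 * ∑ k, W.loadSig k * (W.sig₁ v * W.rot₂ (W.projS v) k
            - W.sig₂ v * W.rot₁ (W.projS v) k) / W.vref k := by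
  rw [W.sig_pair_gVec hΛ, W.dot_syncPart_PhiVec hΛ hne, syncPart, W.dot_embS_eθ_eq_projS hw hne,
    mul_add, Finset.mul_sum, Finset.mul_sum, Finset.mul_sum]
  have h : ∀ k, W.Lam * (2 * (W.loadSig k * (W.sig₁ v / W.Lam * W.rot₂ (W.projS v) k
      - W.sig₂ v / W.Lam * W.rot₁ (W.projS v) k) / W.vref k))
      = 2 * (W.loadSig k * (W.sig₁ v * W.rot₂ (W.projS v) k
          - W.sig₂ v * W.rot₁ (W.projS v) k) / W.vref k) := by
    intro k
    have hk := hne k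
    field_simp
  rw [Finset.sum_congr rfl fun k _ => h k]
  ring

/-- **`d(r²)/dt` along solutions of (17)**: `(2η/Λ²) Σ_i σ_i(v) σ_i(g(v))` (within any time set `s`; the
tree's solution convention `HasDerivWithinAt γ (field (γ t)) s t`, no existence claim).
[cite: GrossEtAl2019, (17) p0006 L9–16] -/
theorem hasDerivWithinAt_rSq {γ : ℝ → DvocState N} {s : Set ℝ} {t : ℝ}
    (hγ : HasDerivWithinAt γ (W.field (γ t)) s t) :
    HasDerivWithinAt (fun τ => W.rSq (γ τ))
      (2 * W.η / W.Lam ^ 2 * (W.sig₁ (γ t) * W.sig₁ (W.gVec (γ t))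
        + W.sig₂ (γ t) * W.sig₂ (W.gVec (γ t)))) s t := by
  have h1 := W.hasDerivWithinAt_fst hγ
  have h2 := W.hasDerivWithinAt_snd hγ
  set f1 : Fin N → ℝ := fun k => W.η * W.g₁ (γ t) k with hf1
  set f2 : Fin N → ℝ := fun k => W.η * W.g₂ (γ t) k with hf2
  have hs1 : HasDerivWithinAt (fun τ => W.sig₁ (γ τ))
      (∑ k, W.vref k * (cos (W.θ k) * f1 k + sin (W.θ k) * f2 k)) s t := by
    have := HasDerivWithinAt.fun_sum (u := Finset.univ) fun k _ =>
      (((h1 k).const_mul (cos (W.θ k))).add ((h2 k).const_mul (sin (W.θ k)))).const_mul (W.vref k)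
    have hf : (fun τ => W.sig₁ (γ τ))
        = fun τ => ∑ k, W.vref k * (cos (W.θ k) * (γ τ).1 k + sin (W.θ k) * (γ τ).2 k) := by
      funext τ; simp only [sig₁]
    rw [hf]
    exact this
  have hs2 : HasDerivWithinAt (fun τ => W.sig₂ (γ τ))
      (∑ k, W.vref k * (-sin (W.θ k) * f1 k + cos (W.θ k) * f2 k)) s t := by
    have := HasDerivWithinAt.fun_sum (u := Finset.univ) fun k _ =>
      (((h1 k).const_mul (-sin (W.θ k))).add ((h2 k).const_mul (cos (W.θ k)))).const_mul
        (W.vref k)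
    have hf : (fun τ => W.sig₂ (γ τ))
        = fun τ => ∑ k, W.vref k * (-sin (W.θ k) * (γ τ).1 k + cos (W.θ k) * (γ τ).2 k) := by
      funext τ; simp only [sig₂]
    rw [hf]
    exact this
  have e2 : (∑ k, W.vref k * (cos (W.θ k) * f1 k + sin (W.θ k) * f2 k))
      = W.η * W.sig₁ (W.gVec (γ t)) := by
    simp only [sig₁, gVec, hf1, hf2, Finset.mul_sum]
    exact Finset.sum_congr rfl fun k _ => by ring
  have e3 : (∑ k, W.vref k * (-sin (W.θ k) * f1 k + cos (W.θ k) * f2 k))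
      = W.η * W.sig₂ (W.gVec (γ t)) := by
    simp only [sig₂, gVec, hf1, hf2, Finset.mul_sum]
    exact Finset.sum_congr rfl fun k _ => by ring
  have h := ((hs1.div_const W.Lam).pow 2).add ((hs2.div_const W.Lam).pow 2)
  have hf : (fun τ => W.rSq (γ τ)) = fun τ => (W.sig₁ (γ τ) / W.Lam) ^ 2 + (W.sig₂ (γ τ) / W.Lam) ^ 2 := by
    funext τ; simp only [rSq]
  rw [hf]
  refine h.congr_deriv ?_
  rw [e2, e3]
  simp only [Nat.cast_ofNat]
  ring


/-- `Λ = Σ_k v_k⋆² > 0` once `Λ ≠ 0`. [cite: GrossEtAl2019, §IV-D p0006 L44–46 (`Σ v_i⋆²`)] -/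
theorem Lam_pos_of_ne (hΛ : W.Lam ≠ 0) : 0 < W.Lam :=
  lt_of_le_of_ne (Finset.sum_nonneg fun k _ => sq_nonneg (W.vref k)) (Ne.symm hΛ)

/-- Cauchy–Schwarz in `ℝ²` for the radial disagreement: `a_k² = ⟨s(v)_k, (P_Sv)_k⟩² ≤ ‖s(v)_k‖²‖(P_Sv)_k‖² =
r² v_k⋆² ‖δ_k‖²` (Lagrange's identity; `s(v) = v − P_Sv` with the printed projector `P_S`).
[cite: GrossEtAl2019, §IV-D p0006 L37–46 (`S`, `P_S`)] -/
theorem radDis_sq_le (v : DvocState N) (k : Fin N) :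
    W.radDis v k ^ 2 ≤ W.rSq v * W.vref k ^ 2 * dvocNsq (W.projS v) k := by
  have hs := W.nsq_syncPart v k
  unfold dvocNsq at hs
  unfold radDis dvocNsq
  have lag : ((W.syncPart v).1 k * (W.projS v).1 k + (W.syncPart v).2 k * (W.projS v).2 k) ^ 2
      + ((W.syncPart v).1 k * (W.projS v).2 k - (W.syncPart v).2 k * (W.projS v).1 k) ^ 2
      = ((W.syncPart v).1 k ^ 2 + (W.syncPart v).2 k ^ 2)
        * ((W.projS v).1 k ^ 2 + (W.projS v).2 k ^ 2) := by ring
  rw [← hs]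
  nlinarith [sq_nonneg ((W.syncPart v).1 k * (W.projS v).2 k
    - (W.syncPart v).2 k * (W.projS v).1 k)]

end DvocReduced

end Literature.MathematicalPhysics.PowerSystems
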